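import Mathlib
import Summits.Ventures.PercRepro2.Defs
import Summits.Ventures.PercRepro2.Independence
import Summits.Ventures.PercRepro2.Harris
import Summits.Ventures.PercRepro2.Graph
import Summits.Ventures.PercRepro2.Events
import Summits.Ventures.PercRepro2.PartitionThree
import Summits.Ventures.PercRepro2.ZCTwoEdge
import Summits.Ventures.PercRepro2.ZCLeafReductions
import Summits.Ventures.PercRepro2.ZCLeafReductionsGraph
import Summits.Ventures.PercRepro2.ZCLeafNonMark
import Summits.Ventures.PercRepro2.ZCLeafRoot
import Summits.Ventures.PercRepro2.ZCZeroWeight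
import Summits.Ventures.PercRepro2.ZCLeafReductionsP

/-!
# The non-mark and root leaf reductions of (ZC) for a `p`-leaf
(blind cell PercRepro2, mine-a g23; MINE-A.md §70.6)

`zc_leaf_nonmark_graph'` and `zc_leaf_root_graph'` are `zc_leaf_nonmark_graph` / `zc_leaf_root_graph`
with «`f` is the only edge at the leaf» weakened to «every other edge at the leaf has weight `0`»
(close them with `prob_eq_closeSet`, then the pointwise structural lemmas of `ZCZeroWeight`).
With `zc_leaf_o_graph'`, `zc_leaf_a3_graph'` this is the full set of leaf reductions in the form
that iterates.  One seat.
-/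

namespace Summit.Ventures.PercRepro2

section LeafGraphP2

variable {V : Type*} [DecidableEq V] {E : Type*} [Fintype E] [DecidableEq E] {R : Type*}
  [CommRing R] [LinearOrder R] [IsStrictOrderedRing R]

omit [LinearOrder R] [IsStrictOrderedRing R] in
/-- **(L0) for a `p`-leaf.**  `v ∉ {a₁, a₃, o}` is joined to the rest by `f = zv` and by edges of
weight `0` only.  Same conclusion as `zc_leaf_nonmark_graph`. -/
theorem zc_leaf_nonmark_graph' (p : E → R) {ends : E → Sym2 V} {a₁ a₃ o v z : V} {f : E}
    (hends : ends f = s(z, v)) (hleaf : ∀ e, v ∈ ends e → e = f ∨ p e = 0) (hv1 : v ≠ a₁)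
    (hv3 : v ≠ a₃) (hvo : v ≠ o) (hvz : v ≠ z) (𝓔 : Set (Set V)) :
    let e := connEvent ends a₁ a₃
    let L := connEvent ends a₁ o
    let U := clusterInEvent ends a₁ 𝓔
    let γ := connEvent ends a₃ o
    let p' := Function.update p f 0
    let 𝓔z : Set (Set V) := {S | (z ∈ S ∧ insert v S ∈ 𝓔) ∨ (z ∉ S ∧ S ∈ 𝓔)}
    let U' := clusterInEvent ends a₁ 𝓔z
    prob p (eᶜ ∩ Lᶜ ∩ γᶜ) * (prob p (U ∩ (e ∩ L)) - prob p U * prob p (e ∩ L))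
      - prob p (eᶜ ∩ Lᶜ ∩ γ) * (prob p (U ∩ (e ∩ Lᶜ)) - prob p U * prob p (e ∩ Lᶜ))
      = (1 - p f) * (prob p' (eᶜ ∩ Lᶜ ∩ γᶜ) * (prob p' (U ∩ (e ∩ L)) - prob p' U * prob p' (e ∩ L))
          - prob p' (eᶜ ∩ Lᶜ ∩ γ) * (prob p' (U ∩ (e ∩ Lᶜ)) - prob p' U * prob p' (e ∩ Lᶜ)))
        + p f * (prob p' (eᶜ ∩ Lᶜ ∩ γᶜ) * (prob p' (U' ∩ (e ∩ L)) - prob p' U' * prob p' (e ∩ L))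
          - prob p' (eᶜ ∩ Lᶜ ∩ γ) * (prob p' (U' ∩ (e ∩ Lᶜ)) - prob p' U' * prob p' (e ∩ Lᶜ))) := by
  intro e L U γ p' 𝓔z U'
  have hzv : z ≠ v := Ne.symm hvz
  set Z : Finset E := Finset.univ.filter (fun e => e ≠ f ∧ v ∈ ends e) with hZdef
  have hZ0 : ∀ e ∈ Z, p e = 0 := by
    intro e he
    simp only [hZdef, Finset.mem_filter, Finset.mem_univ, true_and] at he
    rcases hleaf e he.2 with h | h
    · exact absurd h he.1
    · exact h
  have hfZ : f ∉ Z := by simp [hZdef]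
  have hpt : ∀ ω : Config E, ∀ e, v ∈ ends e → e = f ∨ Z.piecewise (fun _ => false) ω e = false := by
    intro ω e he
    by_cases hef : e = f
    · exact Or.inl hef
    · right
      apply closeSet_apply_of_mem
      simp [hZdef, hef, he]
  have htr : ∀ A : Set (Config E), prob p A = prob p {ω | Z.piecewise (fun _ => false) ω ∈ A} :=
    prob_eq_closeSet p Z hZ0
  have hcf : ∀ ω : Config E, Z.piecewise (fun _ => false) ω f = ω f :=
    fun ω => closeSet_apply_of_not_mem Z ω hfZ
  set E' : Set (Config E) := {ω | Function.update (Z.piecewise (fun _ => false) ω) f false ∈ e} with hE'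
  set L'' : Set (Config E) := {ω | Function.update (Z.piecewise (fun _ => false) ω) f false ∈ L} with hL''
  set γ'' : Set (Config E) := {ω | Function.update (Z.piecewise (fun _ => false) ω) f false ∈ γ} with hγ''
  set X₀ : Set (Config E) := {ω | Function.update (Z.piecewise (fun _ => false) ω) f false ∈ U} with hX₀
  set Xz : Set (Config E) := {ω | Function.update (Z.piecewise (fun _ => false) ω) f false ∈ U'} with hXz
  have he : {ω | Z.piecewise (fun _ => false) ω ∈ e} = E' := by
    ext ω
    simp only [e, E', Set.mem_setOf_eq, mem_connEvent]
    exact conn_leaf_iff_of_ne' hends hzv (hpt ω) (Ne.symm hv1) (Ne.symm hv3)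
  have hL : {ω | Z.piecewise (fun _ => false) ω ∈ L} = L'' := by
    ext ω
    simp only [L, L'', Set.mem_setOf_eq, mem_connEvent]
    exact conn_leaf_iff_of_ne' hends hzv (hpt ω) (Ne.symm hv1) (Ne.symm hvo)
  have hγ : {ω | Z.piecewise (fun _ => false) ω ∈ γ} = γ'' := by
    ext ω
    simp only [γ, γ'', Set.mem_setOf_eq, mem_connEvent]
    exact conn_leaf_iff_of_ne' hends hzv (hpt ω) (Ne.symm hv3) (Ne.symm hvo)
  have hU : {ω | Z.piecewise (fun _ => false) ω ∈ U} = (openEdge f ∩ Xz) ∪ (closedEdge f ∩ X₀) := by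
    ext ω
    simp only [U, Xz, X₀, U', 𝓔z, Set.mem_union, Set.mem_inter_iff, Set.mem_setOf_eq,
      mem_clusterInEvent, mem_openEdge, mem_closedEdge]
    rw [cluster_leaf_eq' hends hzv (hpt ω) (Ne.symm hv1), hcf]
    rcases Bool.eq_false_or_eq_true (ω f) with hf | hf
    · by_cases hz : z ∈ cluster ends (Function.update (Z.piecewise (fun _ => false) ω) f false) a₁
      · have hset : cluster ends (Function.update (Z.piecewise (fun _ => false) ω) f false) a₁
            ∪ {u | u = v ∧ ω f = true ∧ z ∈ cluster ends (Function.update (Z.piecewise (fun _ => false) ω) f false) a₁}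
            = insert v (cluster ends (Function.update (Z.piecewise (fun _ => false) ω) f false) a₁) := by
          ext u; simp [hf, hz]
        rw [hset]; simp [hf, hz]
      · have hset : cluster ends (Function.update (Z.piecewise (fun _ => false) ω) f false) a₁
            ∪ {u | u = v ∧ ω f = true ∧ z ∈ cluster ends (Function.update (Z.piecewise (fun _ => false) ω) f false) a₁}
            = cluster ends (Function.update (Z.piecewise (fun _ => false) ω) f false) a₁ := by
          ext u; simp [hz]
        rw [hset]; simp [hf, hz]
    · have hset : cluster ends (Function.update (Z.piecewise (fun _ => false) ω) f false) a₁
          ∪ {u | u = v ∧ ω f = true ∧ z ∈ cluster ends (Function.update (Z.piecewise (fun _ => false) ω) f false) a₁}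
          = cluster ends (Function.update (Z.piecewise (fun _ => false) ω) f false) a₁ := by
        ext u; simp [hf]
      rw [hset]; simp [hf]
  have inv : ∀ (A : Set (Config E)) (ω : Config E) (b : Bool),
      Function.update ω f b ∈ {ω | Function.update (Z.piecewise (fun _ => false) ω) f false ∈ A} ↔
        ω ∈ {ω | Function.update (Z.piecewise (fun _ => false) ω) f false ∈ A} := by
    intro A ω b
    simp only [Set.mem_setOf_eq, closeSet_update Z hfZ, Function.update_idem]
  have htr' : ∀ A : Set (Config E), prob p' A
      = prob p {ω | Function.update (Z.piecewise (fun _ => false) ω) f false ∈ A} := by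
    intro A
    rw [prob_update_zero_eq_shift, htr]
    rfl
  have key := zc_leaf_nonmark p f γ'' (inv e) (inv L) (inv U) (inv U')
  simp only at key
  rw [htr (eᶜ ∩ Lᶜ ∩ γᶜ), htr (U ∩ (e ∩ L)), htr U, htr (e ∩ L), htr (eᶜ ∩ Lᶜ ∩ γ),
    htr (U ∩ (e ∩ Lᶜ)), htr (e ∩ Lᶜ)]
  simp only [closeSet_setOf_inter₀, closeSet_setOf_compl₀]
  rw [he, hL, hU, hγ]
  simp only [hE', hL'', hγ'', hX₀, hXz] at key ⊢
  simp only [htr', closeSet_setOf_inter, closeSet_setOf_compl]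
  exact key

/-- **(L₁) for a `p`-leaf.**  The root `a₁` is joined to the rest by `f = za₁` and by edges of weight
`0` only.  Same conclusion as `zc_leaf_root_graph`. -/
theorem zc_leaf_root_graph' {p : E → R} (hp : IsProbVec p) {ends : E → Sym2 V} {a₁ a₃ o z : V}
    {f : E} (hends : ends f = s(z, a₁)) (hleaf : ∀ e, a₁ ∈ ends e → e = f ∨ p e = 0) (h13 : a₁ ≠ a₃)
    (h1o : a₁ ≠ o) (h1z : a₁ ≠ z) {𝓔 : Set (Set V)} (h𝓔 : IsUpperSet 𝓔)
    (h𝓔₁ : ({a₁} : Set V) ∉ 𝓔)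
    (hZ : let p' := Function.update p f 0
      let 𝓔' : Set (Set V) := {S | insert a₁ S ∈ 𝓔}
      let e' := connEvent ends z a₃
      let L' := connEvent ends z o
      let U' := clusterInEvent ends z 𝓔'
      let γ' := connEvent ends a₃ o
      0 ≤ prob p' (e'ᶜ ∩ L'ᶜ ∩ γ'ᶜ) * (prob p' (U' ∩ (e' ∩ L')) - prob p' U' * prob p' (e' ∩ L'))
        - prob p' (e'ᶜ ∩ L'ᶜ ∩ γ') * (prob p' (U' ∩ (e' ∩ L'ᶜ)) - prob p' U' * prob p' (e' ∩ L'ᶜ))) :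
    let e := connEvent ends a₁ a₃
    let L := connEvent ends a₁ o
    let U := clusterInEvent ends a₁ 𝓔
    let γ := connEvent ends a₃ o
    let p' := Function.update p f 0
    let 𝓔' : Set (Set V) := {S | insert a₁ S ∈ 𝓔}
    let e' := connEvent ends z a₃
    let L' := connEvent ends z o
    let U' := clusterInEvent ends z 𝓔'
    let γ' := connEvent ends a₃ o
    prob p (eᶜ ∩ Lᶜ ∩ γᶜ) * (prob p (U ∩ (e ∩ L)) - prob p U * prob p (e ∩ L))
      - prob p (eᶜ ∩ Lᶜ ∩ γ) * (prob p (U ∩ (e ∩ Lᶜ)) - prob p U * prob p (e ∩ Lᶜ))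
      ≥ p f * (prob p' (e'ᶜ ∩ L'ᶜ ∩ γ'ᶜ) * (prob p' (U' ∩ (e' ∩ L')) - prob p' U' * prob p' (e' ∩ L'))
          - prob p' (e'ᶜ ∩ L'ᶜ ∩ γ') * (prob p' (U' ∩ (e' ∩ L'ᶜ)) - prob p' U' * prob p' (e' ∩ L'ᶜ))) := by
  intro e L U γ p' 𝓔' e' L' U' γ'
  simp only at hZ
  have hz1 : z ≠ a₁ := Ne.symm h1z
  set Z : Finset E := Finset.univ.filter (fun e => e ≠ f ∧ a₁ ∈ ends e) with hZdef
  have hZ0 : ∀ e ∈ Z, p e = 0 := by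
    intro e he
    simp only [hZdef, Finset.mem_filter, Finset.mem_univ, true_and] at he
    rcases hleaf e he.2 with h | h
    · exact absurd h he.1
    · exact h
  have hfZ : f ∉ Z := by simp [hZdef]
  have hpt : ∀ ω : Config E, ∀ e, a₁ ∈ ends e → e = f ∨ Z.piecewise (fun _ => false) ω e = false := by
    intro ω e he
    by_cases hef : e = f
    · exact Or.inl hef
    · right
      apply closeSet_apply_of_mem
      simp [hZdef, hef, he]
  have htr : ∀ A : Set (Config E), prob p A = prob p {ω | Z.piecewise (fun _ => false) ω ∈ A} :=
    prob_eq_closeSet p Z hZ0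
  have hcf : ∀ ω : Config E, Z.piecewise (fun _ => false) ω f = ω f :=
    fun ω => closeSet_apply_of_not_mem Z ω hfZ
  set Ez : Set (Config E) := {ω | Function.update (Z.piecewise (fun _ => false) ω) f false ∈ e'} with hEz
  set Lz : Set (Config E) := {ω | Function.update (Z.piecewise (fun _ => false) ω) f false ∈ L'} with hLz
  set γz : Set (Config E) := {ω | Function.update (Z.piecewise (fun _ => false) ω) f false ∈ γ'} with hγz
  set X' : Set (Config E) := {ω | Function.update (Z.piecewise (fun _ => false) ω) f false ∈ U'} with hX'
  have he : {ω | Z.piecewise (fun _ => false) ω ∈ e} = openEdge f ∩ Ez := by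
    ext ω
    simp only [e, Ez, e', Set.mem_inter_iff, Set.mem_setOf_eq, mem_connEvent, mem_openEdge]
    constructor
    · intro h
      obtain ⟨hf, hc⟩ := (conn_leaf_iff' hends hz1 (hpt ω) (Ne.symm h13)).1 (conn_symm h)
      rw [hcf] at hf
      exact ⟨hf, conn_symm hc⟩
    · rintro ⟨hf, hc⟩
      rw [← hcf ω] at hf
      exact conn_symm ((conn_leaf_iff' hends hz1 (hpt ω) (Ne.symm h13)).2 ⟨hf, conn_symm hc⟩)
  have hL : {ω | Z.piecewise (fun _ => false) ω ∈ L} = openEdge f ∩ Lz := by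
    ext ω
    simp only [L, Lz, L', Set.mem_inter_iff, Set.mem_setOf_eq, mem_connEvent, mem_openEdge]
    constructor
    · intro h
      obtain ⟨hf, hc⟩ := (conn_leaf_iff' hends hz1 (hpt ω) (Ne.symm h1o)).1 (conn_symm h)
      rw [hcf] at hf
      exact ⟨hf, conn_symm hc⟩
    · rintro ⟨hf, hc⟩
      rw [← hcf ω] at hf
      exact conn_symm ((conn_leaf_iff' hends hz1 (hpt ω) (Ne.symm h1o)).2 ⟨hf, conn_symm hc⟩)
  have hγ : {ω | Z.piecewise (fun _ => false) ω ∈ γ} = γz := by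
    ext ω
    simp only [γ, γz, γ', Set.mem_setOf_eq, mem_connEvent]
    exact conn_leaf_iff_of_ne' hends hz1 (hpt ω) (Ne.symm h13) (Ne.symm h1o)
  have hU : {ω | Z.piecewise (fun _ => false) ω ∈ U} = openEdge f ∩ X' := by
    ext ω
    simp only [U, X', U', 𝓔', Set.mem_inter_iff, Set.mem_setOf_eq, mem_clusterInEvent,
      mem_openEdge]
    rcases Bool.eq_false_or_eq_true (ω f) with hf | hf
    · have hf' : Z.piecewise (fun _ => false) ω f = true := by rw [hcf]; exact hf
      have hconn : Conn ends (Z.piecewise (fun _ => false) ω) a₁ z :=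
        conn_symm (conn_of_openAdj ⟨f, hf', hends⟩)
      rw [cluster_eq_of_conn hconn, cluster_leaf_eq' hends hz1 (hpt ω) (Ne.symm h1z), hf']
      have hset : cluster ends (Function.update (Z.piecewise (fun _ => false) ω) f false) z
          ∪ {u | u = a₁ ∧ true = true ∧ z ∈ cluster ends (Function.update (Z.piecewise (fun _ => false) ω) f false) z}
          = insert a₁ (cluster ends (Function.update (Z.piecewise (fun _ => false) ω) f false) z) := by
        ext u; simp [conn_refl]
      rw [hset]; simp [hf]
    · have hf' : Z.piecewise (fun _ => false) ω f = false := by rw [hcf]; exact hf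
      rw [cluster_leaf_closed' (hpt ω) hf']; simp [hf, h𝓔₁]
  have inv : ∀ (A : Set (Config E)) (ω : Config E) (b : Bool),
      Function.update ω f b ∈ {ω | Function.update (Z.piecewise (fun _ => false) ω) f false ∈ A} ↔
        ω ∈ {ω | Function.update (Z.piecewise (fun _ => false) ω) f false ∈ A} := by
    intro A ω b
    simp only [Set.mem_setOf_eq, closeSet_update Z hfZ, Function.update_idem]
  have hmono : ∀ {ω ω' : Config E}, ω ≤ ω' →
      Function.update (Z.piecewise (fun _ => false) ω) f false
        ≤ Function.update (Z.piecewise (fun _ => false) ω') f false :=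
    fun hle => closeOne_mono f (closeSet_mono Z hle)
  have hEzup : IsUpperSet Ez := fun ω ω' hle hω => conn_mono (hmono hle) hω
  have hLzup : IsUpperSet Lz := fun ω ω' hle hω => conn_mono (hmono hle) hω
  have hγzup : IsUpperSet γz := fun ω ω' hle hω => conn_mono (hmono hle) hω
  have h𝓔'up : IsUpperSet 𝓔' := fun S S' hSS' hS => h𝓔 (Set.insert_subset_insert hSS') hS
  have hX'up : IsUpperSet X' := fun ω ω' hle hω => h𝓔'up (cluster_mono (hmono hle) z) hω
  have hγeq : γz = (Ez ∩ Lz) ∪ (Ezᶜ ∩ Lzᶜ ∩ γz) := by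
    ext ω
    simp only [Ez, Lz, γz, e', L', γ', Set.mem_union, Set.mem_inter_iff, Set.mem_compl_iff,
      Set.mem_setOf_eq, mem_connEvent]
    constructor
    · intro h
      by_cases hz3 : Conn ends (Function.update (Z.piecewise (fun _ => false) ω) f false) z a₃
      · exact Or.inl ⟨hz3, conn_trans hz3 h⟩
      · exact Or.inr ⟨⟨hz3, fun hzo => hz3 (conn_trans hzo (conn_symm h))⟩, h⟩
    · rintro (⟨h1, h2⟩ | ⟨_, h⟩)
      · exact conn_trans (conn_symm h1) h2
      · exact h
  have hp' : IsProbVec p' := hp.update f le_rfl zero_le_one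
  have htr' : ∀ A : Set (Config E), prob p' A
      = prob p {ω | Function.update (Z.piecewise (fun _ => false) ω) f false ∈ A} := by
    intro A
    rw [prob_update_zero_eq_shift, htr]
    rfl
  have hP1 : prob p (Ezᶜ ∩ Lzᶜ ∩ γz) * prob p (Ez ∩ Lzᶜ)
      ≤ prob p (Ezᶜ ∩ Lzᶜ ∩ γzᶜ) * prob p (Ez ∩ Lz) := by
    have h := partitionThree_lattice hp' ends z a₃ o
    rw [partBCa_eq_three, partAll_eq_ab_ac] at h
    simp only [partABc, partApart, htr', closeSet_setOf_inter, closeSet_setOf_compl] at h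
    simp only [hEz, hLz, hγz, e', L', γ']
    linarith [h]
  have htr'' : ∀ A : Set (Config E), prob (Function.update p f 0) A
      = prob p {ω | Function.update (Z.piecewise (fun _ => false) ω) f false ∈ A} := htr'
  have hZ' : 0 ≤ prob p (Ezᶜ ∩ Lzᶜ ∩ γzᶜ) * (prob p (X' ∩ (Ez ∩ Lz)) - prob p X' * prob p (Ez ∩ Lz))
      - prob p (Ezᶜ ∩ Lzᶜ ∩ γz) * (prob p (X' ∩ (Ez ∩ Lzᶜ)) - prob p X' * prob p (Ez ∩ Lzᶜ)) := by
    simp only [htr'', closeSet_setOf_inter, closeSet_setOf_compl] at hZ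
    simp only [hEz, hLz, hγz, hX']
    exact hZ
  have key := zc_leaf_root hp f (inv e') (inv L') (inv γ') (inv U') hEzup hLzup hγzup hX'up hγeq
    hP1 hZ'
  simp only at key
  rw [htr (eᶜ ∩ Lᶜ ∩ γᶜ), htr (U ∩ (e ∩ L)), htr U, htr (e ∩ L), htr (eᶜ ∩ Lᶜ ∩ γ),
    htr (U ∩ (e ∩ Lᶜ)), htr (e ∩ Lᶜ)]
  simp only [closeSet_setOf_inter₀, closeSet_setOf_compl₀]
  rw [he, hL, hU, hγ]
  simp only [hEz, hLz, hγz, hX'] at key ⊢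
  simp only [htr', closeSet_setOf_inter, closeSet_setOf_compl]
  exact key

end LeafGraphP2

end Summit.Ventures.PercRepro2
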